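import Literature.AnabelianGeometry.AbsoluteAnabelian.AbsTopI.RelativeGC
import Literature.AnabelianGeometry.AbsoluteAnabelian.GeneralizedSubpadicCyclotomicProofs
import Literature.AnabelianGeometry.AbsoluteAnabelian.SubpadicSlimProofs
import Literature.AnabelianGeometry.AbsoluteAnabelian.GeneralizedSubpadicSlimProofs
import Literature.AnabelianGeometry.AbsoluteAnabelian.AbsTopIII.KummerFaithfulSubpadicProofs
import HarnessLib

/-!
# [AbsTopI] Example 4.8 (i)/(ii): the FIELD-SIDE clauses are kernel theorems — the named facts
# `Ex_4_8_i` / `Ex_4_8_ii` reduce to chain-fullness + the relative Grothendieck Conjecture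

Authors: abc-iut-L4-t13 (gen 2).

Proof-only companion of `AbsTopI/RelativeGC.lean` (abc-iut-L4-t13 gen 0, p407449; never edited here).
S. Mochizuki, *Topics in Absolute Anabelian Geometry I* [AbsTopI] (bib key `MochizukiAbsTopI2012`,
kurims manuscript pagination), Example 4.8 p. 58, for `𝒟 = 𝕍 × 𝔽 × 𝕊` with `𝔽` = generalized
sub-`p`-adic fields (i) / sub-`p`-adic fields (ii): "The hypotheses of Theorem 4.7, (i), (ii) [resp.
(iii), (iv)], are satisfied relative to this `𝒟`. Indeed, it is immediate that `𝒟` is chain-full; the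
rel-isom-DGC follows from [Mzk5], Theorem 4.12 [resp. the rel-hom-DGC follows from [Mzk3], Theorem A];
the prime `p` clearly serves as a prime “`l`” as in the statement of Theorem 4.7. Moreover, we recall
from [Mzk5], Lemma 4.14 [resp. [Mzk3], Lemma 15.8], that the absolute Galois group of a generalized
sub-`p`-adic field [resp. sub-`p`-adic field] is always slim."

`RelativeGC.lean` types each as a named fact with FOUR clauses (chain-full ∧ GC ∧ `χ_p` open ∧ `G_k`
slim) and reduces it to inputs (`ex_4_8_i_of`, `ex_4_8_ii_of`).  Since then the cell has PROVED the
field-side inputs: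

* slimness: `pGC.lem_15_8_slim_holds` ([pGC] Lem 15.8, abc-iut-L4-d2, `SubpadicSlimProofs.lean`) for
  sub-`p`-adic fields; for generalized sub-`p`-adic fields [Tpcs] Lem 4.14 is abc-iut-L4-d1's
  `Tpcs.lem_4_14_slim_holds` (`GeneralizedSubpadicSlimProofs.lean`, landed after the first version of
  this file — `ex_4_8_i_of_relIsomDGC` keeps the hypothesis `Tpcs.Lem_4_14_slim`, the appended
  `ex_4_8_i_of_relIsomDGC'` / `ex_4_8_i_of_thm_4_12'` / `slim_of_isEx48ClassGen` discharge it);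
* "`p` serves as `l`": `AbsTopIII.IsSubpadic.isOpen_range_cyclotomicChar` ([AbsTopIII] Rmk 1.5.4 (i)
  ∘ Rmk 1.5.1, abc-iut-L4-d1/d2/d3/t17) for sub-`p`-adic fields, and
  `AbsTopIII.IsGeneralizedSubpadicFor.isOpen_range_cyclotomicChar`
  (`GeneralizedSubpadicCyclotomicProofs.lean`, abc-iut-L4-t13 gen 2) for generalized sub-`p`-adic ones.

Hence (this file) `Ex_4_8_ii` holds for EVERY class `𝒟` that is chain-full and satisfies the
rel-hom-DGC (`ex_4_8_ii_of_relHomDGC`) — i.e. modulo exactly its scheme-side clause and [pGC] Thm A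
(`relHomGC_curves_of_thmA` supplies the latter on curve members) —, and `Ex_4_8_i` holds for every
chain-full `𝒟` satisfying the rel-isom-DGC, given [Tpcs] Lem 4.14 (`ex_4_8_i_of_relIsomDGC`).  This is
the FACT boundary of the cell's LC1 chain (`plan/L4/LC1-CHAIN.md` §1f) with all field-theoretic
entries removed.

HONEST FRAMING: the GC theorems ([Tpcs] Thm 4.12, [pGC] Thm A) and the scheme-side chain-fullness stay
hypotheses (campaign-L base); nothing here bears on [IUTchIII] Cor 3.12; typed ≠ discharged.
Proof-only, no definitions.
-/

noncomputable section

namespace Literature.AnabelianGeometry.AbsoluteAnabelian.AbsTopI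

open Literature.AlgebraicGeometry.Frobenioids (IsSlimGroup)

universe u

namespace ConstructionDataClass

variable {𝒟 : ConstructionDataClass.{u}}

/-- The cyclotomic clause of [AbsTopI] Example 4.8 (i) p. 58 ("the prime `p` clearly serves as a
prime “`l`” as in the statement of Theorem 4.7") for the class over GENERALIZED sub-`p`-adic fields,
PROVED: `χ_p : G_{k_b} → ℤ_p^×` has open image for every construction-data field `k_b`
(`AbsTopIII.IsGeneralizedSubpadicFor.isOpen_range_cyclotomicChar`). [cite: MochizukiAbsTopI2012, Ex 4.8 (i) p.58] -/
theorem cyclotomic_of_isEx48ClassGen {p : ℕ} [Fact p.Prime] (h𝒟 : 𝒟.IsEx48ClassGen p)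
    (b : 𝒟.Base) : IsOpen (Set.range (AbsTopIII.cyclotomicChar (𝒟.fld b) p)) :=
  (h𝒟.generalizedSubpadic b).isOpen_range_cyclotomicChar

/-- The cyclotomic clause of [AbsTopI] Example 4.8 (ii) p. 58 for the class over sub-`p`-adic fields,
PROVED unconditionally (`AbsTopIII.IsSubpadic.isOpen_range_cyclotomicChar`, [AbsTopIII] Rmk 1.5.4 (i)
∘ Rmk 1.5.1; compare `cyclotomic_of_rmk_1_5_4_i`, which took both remarks as hypotheses).
[cite: MochizukiAbsTopI2012, Ex 4.8 (ii) p.58] -/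
theorem cyclotomic_of_isEx48ClassSub {p : ℕ} [Fact p.Prime] (h𝒟 : 𝒟.IsEx48ClassSub p)
    (b : 𝒟.Base) : IsOpen (Set.range (AbsTopIII.cyclotomicChar (𝒟.fld b) p)) :=
  (⟨⟨p, inferInstance, h𝒟.subpadic b⟩⟩ : AbsTopIII.IsSubpadic (𝒟.fld b)).isOpen_range_cyclotomicChar p

/-- The slimness clause of [AbsTopI] Example 4.8 (ii) p. 58 ("we recall from [Mzk3], Lemma 15.8, that
the absolute Galois group of a sub-`p`-adic field is always slim"), PROVED unconditionally
(`pGC.lem_15_8_slim_holds`, abc-iut-L4-d2). [cite: MochizukiAbsTopI2012, Ex 4.8 (ii) p.58] -/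
theorem slim_of_isEx48ClassSub {p : ℕ} [Fact p.Prime] (h𝒟 : 𝒟.IsEx48ClassSub p) (b : 𝒟.Base) :
    IsSlimGroup (Field.absoluteGaloisGroup (𝒟.fld b)) :=
  slim_of_lem_15_8 h𝒟 pGC.lem_15_8_slim_holds b

/-- **[AbsTopI] Example 4.8 (ii) modulo its scheme side and [pGC] Thm A only**: for any class `𝒟`
that is chain-full and satisfies the rel-hom-DGC, the named fact `Ex_4_8_ii` HOLDS — the cyclotomic
and slimness clauses being kernel theorems (`cyclotomic_of_isEx48ClassSub`, `slim_of_isEx48ClassSub`).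
[cite: MochizukiAbsTopI2012, Ex 4.8 (ii) p.58] -/
theorem ex_4_8_ii_of_relHomDGC {p : ℕ} [Fact p.Prime] (hfull : 𝒟.IsChainFull)
    (hGC : 𝒟.RelHomDGC) : 𝒟.Ex_4_8_ii p :=
  fun h𝒟 => ⟨hfull, hGC, cyclotomic_of_isEx48ClassSub h𝒟, slim_of_isEx48ClassSub h𝒟⟩

/-- **[AbsTopI] Example 4.8 (i) modulo its scheme side, [Tpcs] Thm 4.12 and [Tpcs] Lem 4.14**: for
any class `𝒟` that is chain-full and satisfies the rel-isom-DGC, the named fact `Ex_4_8_i` holds given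
the slimness lemma `Tpcs.Lem_4_14_slim` — the cyclotomic clause ("the prime `p` clearly serves as a
prime “`l`”") being now a kernel theorem for generalized sub-`p`-adic fields
(`cyclotomic_of_isEx48ClassGen`); compare `ex_4_8_i_of`, which took it as the hypothesis `hcyc`.
[cite: MochizukiAbsTopI2012, Ex 4.8 (i) p.58] -/
theorem ex_4_8_i_of_relIsomDGC {p : ℕ} [Fact p.Prime] (hfull : 𝒟.IsChainFull) (hGC : 𝒟.RelIsomDGC)
    (hslim : Tpcs.Lem_4_14_slim.{u}) : 𝒟.Ex_4_8_i p :=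
  fun h𝒟 => ⟨hfull, hGC, cyclotomic_of_isEx48ClassGen h𝒟, slim_of_lem_4_14 h𝒟 hslim⟩

/-- [AbsTopI] Example 4.8 (i) for a class of hyperbolic CURVES over generalized sub-`p`-adic fields,
from the PRINTED inputs: chain-fullness, [Tpcs] Thm 4.12 field by field (`Tpcs.Thm_4_12`, via
`relIsomGC_curves_of_thm_4_12`) and [Tpcs] Lem 4.14 (`Tpcs.Lem_4_14_slim`).  The membership hypothesis
`hcurve` says every member is a hyperbolic curve (the orbicurve members of the printed `𝕍` are not
covered by `Tpcs.Thm_4_12` as typed). [cite: MochizukiAbsTopI2012, Ex 4.8 (i) p.58] -/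
theorem ex_4_8_i_of_thm_4_12 {p : ℕ} [Fact p.Prime] (hfull : 𝒟.IsChainFull)
    (hcurve : ∀ b X, 𝒟.Mem b X → (𝒟.datum b).IsHyperbolicCurve X)
    (hGC : ∀ b, Tpcs.Thm_4_12 p (𝒟.fld b) (𝒟.datum b)) (hslim : Tpcs.Lem_4_14_slim.{u}) :
    𝒟.Ex_4_8_i p :=
  fun h𝒟 => ⟨hfull,
    fun b X₁ X₂ h₁ h₂ => relIsomGC_curves_of_thm_4_12 h𝒟 hGC b X₁ X₂ (hcurve b X₁ h₁) (hcurve b X₂ h₂),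
    cyclotomic_of_isEx48ClassGen h𝒟, slim_of_lem_4_14 h𝒟 hslim⟩

/-- [AbsTopI] Example 4.8 (ii) for a class of hyperbolic CURVES over sub-`p`-adic fields, from the
PRINTED inputs: chain-fullness and [pGC] Thm A field by field (`pGC.ThmA`, via
`relHomGC_curves_of_thmA`); slimness and the cyclotomic clause are kernel theorems.
[cite: MochizukiAbsTopI2012, Ex 4.8 (ii) p.58] -/
theorem ex_4_8_ii_of_thmA {p : ℕ} [Fact p.Prime] (hfull : 𝒟.IsChainFull)
    (hcurve : ∀ b X, 𝒟.Mem b X → (𝒟.datum b).IsHyperbolicCurve X)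
    (hGC : ∀ b, pGC.ThmA (𝒟.fld b) (𝒟.datum b)) : 𝒟.Ex_4_8_ii p :=
  fun h𝒟 => ⟨hfull,
    fun b X₁ X₂ _ h₂ => relHomGC_curves_of_thmA h𝒟 hGC b X₁ X₂ (hcurve b X₂ h₂),
    cyclotomic_of_isEx48ClassSub h𝒟, slim_of_isEx48ClassSub h𝒟⟩

/-! ### Appended after [Tpcs] Lem 4.14 landed (`Tpcs.lem_4_14_slim_holds`, abc-iut-L4-d1) -/

/-- The slimness clause of [AbsTopI] Example 4.8 (i) p. 58 ("we recall from [Mzk5], Lemma 4.14, that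
the absolute Galois group of a generalized sub-`p`-adic field is always slim"), PROVED unconditionally
(`Tpcs.lem_4_14_slim_holds`, abc-iut-L4-d1). [cite: MochizukiAbsTopI2012, Ex 4.8 (i) p.58] -/
theorem slim_of_isEx48ClassGen {p : ℕ} [Fact p.Prime] (h𝒟 : 𝒟.IsEx48ClassGen p) (b : 𝒟.Base) :
    IsSlimGroup (Field.absoluteGaloisGroup (𝒟.fld b)) :=
  slim_of_lem_4_14 h𝒟 Tpcs.lem_4_14_slim_holds b

/-- **[AbsTopI] Example 4.8 (i) modulo its scheme side and [Tpcs] Thm 4.12 ONLY**: for any class `𝒟`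
that is chain-full and satisfies the rel-isom-DGC, the named fact `Ex_4_8_i` HOLDS — the cyclotomic
clause (`cyclotomic_of_isEx48ClassGen`, abc-iut-L4-t13) and the slimness clause
(`slim_of_isEx48ClassGen`, via abc-iut-L4-d1) being kernel theorems.  Symmetric to
`ex_4_8_ii_of_relHomDGC`. [cite: MochizukiAbsTopI2012, Ex 4.8 (i) p.58] -/
theorem ex_4_8_i_of_relIsomDGC' {p : ℕ} [Fact p.Prime] (hfull : 𝒟.IsChainFull)
    (hGC : 𝒟.RelIsomDGC) : 𝒟.Ex_4_8_i p :=
  ex_4_8_i_of_relIsomDGC hfull hGC Tpcs.lem_4_14_slim_holds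

/-- [AbsTopI] Example 4.8 (i) for a class of hyperbolic CURVES over generalized sub-`p`-adic fields
from the PRINTED inputs chain-fullness and [Tpcs] Thm 4.12 alone (`Tpcs.Thm_4_12` field by field);
[Tpcs] Lem 4.14 and "`p` serves as `l`" are kernel theorems. [cite: MochizukiAbsTopI2012, Ex 4.8 (i) p.58] -/
theorem ex_4_8_i_of_thm_4_12' {p : ℕ} [Fact p.Prime] (hfull : 𝒟.IsChainFull)
    (hcurve : ∀ b X, 𝒟.Mem b X → (𝒟.datum b).IsHyperbolicCurve X)
    (hGC : ∀ b, Tpcs.Thm_4_12 p (𝒟.fld b) (𝒟.datum b)) : 𝒟.Ex_4_8_i p :=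
  ex_4_8_i_of_thm_4_12 hfull hcurve hGC Tpcs.lem_4_14_slim_holds

end ConstructionDataClass

end Literature.AnabelianGeometry.AbsoluteAnabelian.AbsTopI
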